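import Summits.AtomisticToContinuum.Crystallization.Theorems.ChargedEnergyGapAffineChargingB
import HarnessLib

/-!
# NODE 65 «AffineChart» part 29b: affine charging — strain bound, affine bond/site forms, core kernel, excision splits, site completion, core refold, ★★★ P-Xᵃ geometric charging form, affine sub-family glue — part 3 of 3 (sequel of `…ChargedEnergyGapAffineChargingB`)

Split for the 400-line cap by the landing lane (hand-2 g33); the module docstring of part 1 (`…ChargedEnergyGapAffineChargingA`) describes the whole node.  Same namespace; all FQNs unchanged.
0 sorry; standard axioms.
-/

noncomputable section
open scoped Classical
open Literature.MathematicalPhysics.StatisticalMechanics Literature.Geometry.DiscreteGeometry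
open Summit.AtomisticToContinuum.Crystallization.Theses.PricedLinkCensus
open Summit.AtomisticToContinuum.Crystallization.Theorems.ChargedEnergyGapNegative

namespace Summit.AtomisticToContinuum.Crystallization.Theorems.ChargedEnergyGapChartDial

/-! ## §I  ★★★ P-Xᵃ: the geometric charging form of the affine instances -/
section AffineModel

variable (ϱχ : ℝ) {m : ℕ} (D : Fin m → Set E3) (σ : Fin m → Bool) {P : PeriodicConfiguration 3} (X : Set E3) (ϱ : ℝ) (C : Set E3)

/-- From sitewise stability at a site: the NUMERICAL-RADIUS bound `|⟪x, A x⟫| ≤ b‖x‖²` with `κb² ≤ Q` (`b = √(Q/κ)`). -/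
theorem exists_numRadius_of_stability {κ : ℝ} (hκ : 0 < κ) {A : E3 →ₗ[ℝ] E3} {Q : ℝ}
    (hst : ∀ u : E3, ‖u‖ = 1 → κ * inner ℝ u (A u) ^ 2 ≤ Q) :
    ∃ b : ℝ, 0 ≤ b ∧ κ * b ^ 2 ≤ Q ∧ ∀ x, |inner ℝ x (A x)| ≤ b * ‖x‖ ^ 2 := by
  obtain ⟨u₀, hu₀⟩ := exists_norm_eq E3 zero_le_one
  have hQ0 : 0 ≤ Q := le_trans (mul_nonneg hκ.le (sq_nonneg _)) (hst u₀ hu₀)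
  refine ⟨Real.sqrt (Q / κ), Real.sqrt_nonneg _, ?_, fun x => ?_⟩
  · rw [Real.sq_sqrt (div_nonneg hQ0 hκ.le), mul_div_cancel₀ _ hκ.ne']
  · by_cases hx : x = 0
    · simp [hx]
    · have hn : 0 < ‖x‖ := norm_pos_iff.2 hx
      set u : E3 := ‖x‖⁻¹ • x with hu
      have hu1 : ‖u‖ = 1 := by rw [hu, norm_smul, Real.norm_eq_abs, abs_of_pos (inv_pos.2 hn), inv_mul_cancel₀ hn.ne']
      have hxu : x = ‖x‖ • u := by rw [hu, smul_smul, mul_inv_cancel₀ hn.ne', one_smul]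
      have hin : inner ℝ x (A x) = ‖x‖ ^ 2 * inner ℝ u (A u) := by
        conv_lhs => rw [hxu]
        rw [map_smul, real_inner_smul_left, real_inner_smul_right]
        ring
      have h1 : inner ℝ u (A u) ^ 2 ≤ Q / κ := by
        rw [le_div_iff₀ hκ, mul_comm]
        exact hst u hu1
      have h2 : |inner ℝ u (A u)| ≤ Real.sqrt (Q / κ) := Real.abs_le_sqrt h1
      rw [hin, abs_mul, abs_of_nonneg (sq_nonneg _), mul_comm]
      exact mul_le_mul_of_nonneg_right h2 (sq_nonneg _)

/-- ★★★ **P-Xᵃ — THE GEOMETRIC CHARGING FORM OF THE AFFINE INSTANCES.**  On a site-stress-free, `s`-separated reference (`0 < s ≤ 3ϱ/8`,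
`2 ≤ 3ϱ/8`), for an affine field with `SmallStrain τ` outside the invariant excised set `X`, `λ > 0`, and SITEWISE STABILITY `κ·⟪u, A u⟫² ≤
q^∅_y(A)` (`κ > 0`) at every motif site:
`modelFarL(affineField A) ≥ −(F⋆/(16λκ) + λτ²/4)·farResidue − (τ/2 + 7λτ²/2)·coreMassL(X ∩ nearZone)`,
`F⋆` = the sharp far tail constant at `R = 3ϱ/8` (any shell thickness `h > 0`).  Per paying site: the unexcised linear term vanishes
(site-stress-free), the excised far bonds cost `½b·E_far(y)` to first order (`b` = numerical radius of `A`, `E_far(y) ≤ F⋆`) against the credit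
`λκb²` — COMPLETE THE SQUARE: `≥ −E_far(y)²/(16λκ) ≥ −(F⋆/(16λκ))·E_far(y)`; the quadratic far debit is `≤ ¼λτ²·E_far(y)` (softening
regime `V″ ≤ 0` beyond `d = 2`); the near bonds are charged to the core kernel. -/
theorem modelFarL_affine_ge {s τ lamQ κ h : ℝ} (hS : IsSiteStressFree P) (hsep : IsSeparatedRef s P) (hs : 0 < s) (hϱ2 : 2 ≤ 3 * ϱ / 8)
    (hsϱ : s ≤ 3 * ϱ / 8) (hh : 0 < h) (hlam : 0 < lamQ) (hκ : 0 < κ) (hτ : 0 ≤ τ) {A : E3 →ₗ[ℝ] E3}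
    (hW : SmallStrain τ P X (affineField A)) (hX : IsInvariantSet P X)
    (hst : ∀ y ∈ P.motif, ∀ u : E3, ‖u‖ = 1 → κ * inner ℝ u (A u) ^ 2 ≤ quadSite (affineField A) P ∅ y) :
    -(((2 * h / s + 2) * (2 / s) ^ 2 * ((3 * ϱ / 8 + h + s / 2) / (3 * ϱ / 8)) ^ 2 * (3 / (3 * ϱ / 8) ^ 4 + 1 / (h * (3 * ϱ / 8) ^ 3)) /
            (16 * lamQ * κ) + lamQ * τ ^ 2 / 4) * farResidue ϱχ D σ P X ϱ C) -
        (τ / 2 + 7 / 2 * lamQ * τ ^ 2) * coreMassL ϱχ D σ P X ϱ C (X ∩ nearZone ϱχ D σ P X ϱ C) ≤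
      modelFarL ϱχ D σ (affineField A) P X lamQ ϱ C := by
  set F : ℝ := (2 * h / s + 2) * (2 / s) ^ 2 * ((3 * ϱ / 8 + h + s / 2) / (3 * ϱ / 8)) ^ 2 *
    (3 / (3 * ϱ / 8) ^ 4 + 1 / (h * (3 * ϱ / 8) ^ 3)) with hF
  set N : Set E3 := nearZone ϱχ D σ P X ϱ C with hN
  set cF : ℝ := F / (16 * lamQ * κ) + lamQ * τ ^ 2 / 4 with hcF
  set cN : ℝ := τ / 2 + 7 / 2 * lamQ * τ ^ 2 with hcN
  unfold farResidue tensionMassL coreMassL modelFarL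
  rw [Finset.mul_sum, Finset.mul_sum, ← Finset.sum_neg_distrib, ← Finset.sum_sub_distrib]
  refine Finset.sum_le_sum fun y hy => ?_
  by_cases hyX : y ∈ X
  · rw [if_pos hyX, if_pos hyX, if_pos hyX, mul_zero, mul_zero, neg_zero, sub_zero]
  rw [if_neg hyX, if_neg hyX, if_neg hyX]
  have hyP : y ∈ P.points := P.mem_points_of_mem_motif hy
  have hχ := localFactor_nonneg (ϱχ := ϱχ) (D := D) (σ := σ) y
  have hw := profileWeight_nonneg ϱ C y
  by_cases hpos : 0 < localFactor ϱχ D σ y * profileWeight ϱ C y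
  · have ha : ∀ x, ‖A x‖ ≤ τ * ‖x‖ := smallStrain_affine_bound hτ hW hX hyP hyX
    obtain ⟨b, hb0, hQ, hb⟩ := exists_numRadius_of_stability hκ (hst y hy)
    have hfar : ∀ z ∈ P.points, z ∈ X → z ∉ N → 3 * ϱ / 8 ≤ dist y z :=
      fun z _ _ hz => le_dist_of_not_mem_nearZone hyP hyX hpos hz
    have hFy : excisionSum P (X \ N) y ≤ F := excisionSum_far_le_sharp hsep hs (by linarith) hsϱ hh hyP hyX hpos
    have hsite := affine_site_bound X N A hS hy hlam hκ hτ ha hb hQ hϱ2 hfar hFy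
    calc -(cF * (localFactor ϱχ D σ y * (profileWeight ϱ C y * excisionSum P (X \ N) y))) -
          cN * (localFactor ϱχ D σ y * (profileWeight ϱ C y * coreSum P (X ∩ N) y))
        = (localFactor ϱχ D σ y * profileWeight ϱ C y) * (-(cF * excisionSum P (X \ N) y) - cN * coreSum P (X ∩ N) y) := by ring
      _ ≤ (localFactor ϱχ D σ y * profileWeight ϱ C y) *
            (linSite (affineField A) P X y + lamQ * quadSite (affineField A) P X y) := mul_le_mul_of_nonneg_left hsite hpos.le
      _ = _ := by ring
  · have h0 : localFactor ϱχ D σ y * profileWeight ϱ C y = 0 := le_antisymm (not_lt.1 hpos) (mul_nonneg hχ hw)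
    have e1 : ∀ t : ℝ, localFactor ϱχ D σ y * (profileWeight ϱ C y * t) = 0 := fun t => by rw [← mul_assoc, h0, zero_mul]
    rw [e1, e1, e1, mul_zero, mul_zero, neg_zero, sub_zero]

end AffineModel

/-! ## §J  ★★★ The affine sub-family from sitewise affine stability and the (R3) bulk bound -/
section AffineGlue

variable {s lam ℓ μ₀ τ lamQ ϱ b₀ r_S C_T ϱχ Cχ : ℝ}

/-- ★★★ **THE AFFINE SUB-FAMILY OF (H𝄪ᴮ) FROM ITS TWO INPUTS.**  With the sharp tail `F⋆ ≤ κ_t` at `R = 3ϱ/8 ≥ 2`, `0 < s ≤ 3ϱ/8`,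
`λ > 0`, `κ > 0`, sitewise affine stability `SitewiseAffineStabilityB s lam ℓ μ₀ κ` and the bulk far-residue bound
`BulkFarResidueBoundB s lam ℓ μ₀ ϱ ϱχ B_T B_χ B_H`, the affine sub-family holds at `(C_T, Cχ)` as soon as
`(κ_t/(16λκ) + λτ²/4)·(B_T + κ_t) ≤ C_T` and `(κ_t/(16λκ) + λτ²/4)·(B_χ + κ_t) ≤ Cχ` (P-Xᵃ + self-charging P-Z₃ + near-core charging §H;
`C_H = (κ_t/(16λκ) + λτ²/4)·B_H + (τ/2 + 7λτ²/2)·(1024/(s³s⁹) + 1024/(s³s³))`). -/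
theorem affineFamilyB_of_bulkB {B_T B_χ B_H κ : ℝ} (hs : 0 < s) (hϱ2 : 2 ≤ 3 * ϱ / 8) (hsϱ : s ≤ 3 * ϱ / 8)
    {h : ℝ} (hh : 0 < h) (hlam : 0 < lamQ) (hτ : 0 ≤ τ) (hκ : 0 < κ) (hBH : 0 ≤ B_H) (hA : SitewiseAffineStabilityB s lam ℓ μ₀ κ)
    (hB : BulkFarResidueBoundB s lam ℓ μ₀ ϱ ϱχ B_T B_χ B_H) (κt : ℝ)
    (hκt : (2 * h / s + 2) * (2 / s) ^ 2 * ((3 * ϱ / 8 + h + s / 2) / (3 * ϱ / 8)) ^ 2 * (3 / (3 * ϱ / 8) ^ 4 + 1 / (h * (3 * ϱ / 8) ^ 3)) ≤ κt)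
    (hT : (κt / (16 * lamQ * κ) + lamQ * τ ^ 2 / 4) * (B_T + κt) ≤ C_T)
    (hχ : (κt / (16 * lamQ * κ) + lamQ * τ ^ 2 / 4) * (B_χ + κt) ≤ Cχ) :
    AffineFamilyB s lam ℓ μ₀ τ lamQ ϱ b₀ r_S C_T ϱχ Cχ := by
  have hF0 : 0 < (2 * h / s + 2) * (2 / s) ^ 2 * ((3 * ϱ / 8 + h + s / 2) / (3 * ϱ / 8)) ^ 2 *
      (3 / (3 * ϱ / 8) ^ 4 + 1 / (h * (3 * ϱ / 8) ^ 3)) := sharpTailConst_pos hs hh (by linarith : (0 : ℝ) < 3 * ϱ / 8)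
  have hκt0 : 0 ≤ κt := hF0.le.trans hκt
  have hcF0 : 0 ≤ κt / (16 * lamQ * κ) + lamQ * τ ^ 2 / 4 := by positivity
  have hcN0 : 0 ≤ τ / 2 + 7 / 2 * lamQ * τ ^ 2 := by positivity
  have hKs0 : (0 : ℝ) ≤ 1024 / (s ^ 3 * s ^ 9) + 1024 / (s ^ 3 * s ^ 3) := by positivity
  refine ⟨(κt / (16 * lamQ * κ) + lamQ * τ ^ 2 / 4) * B_H + (τ / 2 + 7 / 2 * lamQ * τ ^ 2) * (1024 / (s ^ 3 * s ^ 9) + 1024 / (s ^ 3 * s ^ 3)),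
    by positivity, ?_⟩
  intro P C X A S m D σ hsep hlab hb hF hS hH' hC hX _ _ hW hD
  rw [volterraField_fin_zero] at hW ⊢
  have hst : ∀ y ∈ P.motif, ∀ u : E3, ‖u‖ = 1 → κ * inner ℝ u (A u) ^ 2 ≤ quadSite (affineField A) P ∅ y :=
    fun y hy u hu => hA P hsep hlab hb hF hS hH' y hy A u hu
  have h1 := modelFarL_affine_ge ϱχ D σ X ϱ C hS hsep hs hϱ2 hsϱ hh hlam hκ hτ hW hX hst
  have h2 := farResidue_le_selfCharge ϱχ D σ X ϱ C hsep hs (by linarith) hsϱ hh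
  have h3 := hB P C X m D σ hsep hlab hb hF hS hH' hC hX hD
  have h4 := coreMassL_near_le ϱχ σ ϱ hsep hs hX hC hD
  have hsh := shellMassL_nonneg ϱχ D σ P X ϱ C
  have htr := transMassL_nonneg ϱχ D σ P X ϱ C
  have hpr : (0 : ℝ) ≤ (pricedNearCountL ϱχ D σ P X ϱ C : ℝ) := Nat.cast_nonneg _
  have hfr : 0 ≤ farResidue ϱχ D σ P X ϱ C := by
    unfold farResidue tensionMassL
    exact Finset.sum_nonneg fun y _ => by
      split_ifs
      · exact le_rfl
      · exact mul_nonneg (localFactor_nonneg (ϱχ := ϱχ) (D := D) (σ := σ) y)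
          (mul_nonneg (profileWeight_nonneg ϱ C y) (excisionSum_nonneg P _ y))
  have hcm := coreMassL_nonneg ϱχ D σ P X ϱ C (X ∩ nearZone ϱχ D σ P X ϱ C)
  -- the far coefficient of P-Xᵃ is at most the budgeted one (F⋆ ≤ κt)
  have hcoef : (2 * h / s + 2) * (2 / s) ^ 2 * ((3 * ϱ / 8 + h + s / 2) / (3 * ϱ / 8)) ^ 2 * (3 / (3 * ϱ / 8) ^ 4 + 1 / (h * (3 * ϱ / 8) ^ 3)) /
        (16 * lamQ * κ) + lamQ * τ ^ 2 / 4 ≤ κt / (16 * lamQ * κ) + lamQ * τ ^ 2 / 4 := by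
    have h16 : 0 < 16 * lamQ * κ := by positivity
    have := div_le_div_of_nonneg_right hκt h16.le
    linarith
  -- farResidue ≤ (B_T + κt)·shell + (B_χ + κt)·trans + B_H·priced
  have hκM := mul_le_mul_of_nonneg_right hκt (add_nonneg hsh htr)
  have hfar : farResidue ϱχ D σ P X ϱ C ≤ (B_T + κt) * shellMassL ϱχ D σ P X ϱ C + (B_χ + κt) * transMassL ϱχ D σ P X ϱ C +
      B_H * (pricedNearCountL ϱχ D σ P X ϱ C : ℝ) := by linarith
  have h5 := mul_le_mul_of_nonneg_right hcoef hfr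
  have h6 := mul_le_mul_of_nonneg_left hfar hcF0
  have h7 := mul_le_mul_of_nonneg_left h4 hcN0
  have h8 := mul_le_mul_of_nonneg_right hT hsh
  have h9 := mul_le_mul_of_nonneg_right hχ htr
  linarith

/-- ★★★ **NODE 65 — THE RECORD AFFINE SUB-FAMILY**: sitewise affine stability at `κ = 1/5` of the admissible class `(s, lam, ℓ, μ₀) = (3/5, 1/3, 3,
1/100)` together with the (R3) bulk bound `BulkFarResidueBoundB (3/5) (1/3) 3 (1/100) 160 80 (1/2100) (1/46) B_H` (PROVED at
`B_H = 5·10⁷·226981`, g65 `bulkFarResidueBoundB_record`) give `AffineFamilyB (3/5) (1/3) 3 (1/100) (3/100) (1/2) 160 (2/5) 3 (1/3000000) 80 (1/100000)`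
(`κ_t = 1/3800`, `h = 12/5`: `(1/6080 + 9/80000)·(1/2100 + 1/3800) ≈ 2.05·10⁻⁷ ≤ 3.33·10⁻⁷`, `·(1/46 + 1/3800) ≈ 6.1·10⁻⁶ ≤ 10⁻⁵`). -/
theorem affineFamilyB_record_of_stability_of_bulkBoundB {B_H : ℝ} (hBH : 0 ≤ B_H)
    (hA : SitewiseAffineStabilityB (3 / 5) (1 / 3) 3 (1 / 100) (1 / 5))
    (hB : BulkFarResidueBoundB (3 / 5) (1 / 3) 3 (1 / 100) 160 80 (1 / 2100) (1 / 46) B_H) :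
    AffineFamilyB (3 / 5) (1 / 3) 3 (1 / 100) (3 / 100) (1 / 2) 160 (2 / 5) 3 (1 / 3000000) 80 (1 / 100000) :=
  affineFamilyB_of_bulkB (by norm_num) (by norm_num) (by norm_num) (h := 12 / 5) (by norm_num) (by norm_num) (by norm_num) (by norm_num) hBH hA hB
    (1 / 3800) (by norm_num) (by norm_num) (by norm_num)

/-- The budget numerals of the record affine sub-family, displayed. -/
theorem record_affine_numerals :
    ((1 : ℝ) / 3800 / (16 * (1 / 2) * (1 / 5)) + (1 / 2) * (3 / 100) ^ 2 / 4) * (1 / 2100 + 1 / 3800) ≤ 1 / 3000000 ∧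
      ((1 : ℝ) / 3800 / (16 * (1 / 2) * (1 / 5)) + (1 / 2) * (3 / 100) ^ 2 / 4) * (1 / 46 + 1 / 3800) ≤ 1 / 100000 ∧
      ((1 : ℝ) / 3800 / (16 * (1 / 2) * (1 / 10)) + (1 / 2) * (3 / 100) ^ 2 / 4) * (1 / 2100 + 1 / 3800) ≤ 1 / 3000000 ∧
      ¬ ((1 : ℝ) / 3800 / (16 * (1 / 2) * (1 / 12)) + (1 / 2) * (3 / 100) ^ 2 / 4) * (1 / 2100 + 1 / 3800) ≤ 1 / 3000000 := by
  refine ⟨by norm_num, by norm_num, by norm_num, by norm_num⟩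

end AffineGlue

end Summit.AtomisticToContinuum.Crystallization.Theorems.ChargedEnergyGapChartDial

end
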